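import Mathlib.LinearAlgebra.Matrix.PosDef
import Mathlib.Algebra.Order.Star.Real
import Mathlib.Topology.Order.Bornology
import Mathlib.MeasureTheory.Measure.Lebesgue.Basic
import Literature.NumberTheory.Transcendental.KZCalculus
import HarnessLib

/-!
# The two-rebit Hilbert–Schmidt separability probability `29/64` (Lovas–Andai 2017)

Family `periods`, layer `Literature/InformationTheory/Entanglement`. Consumer: route
KontsevichZagierPeriods/SpectrahedralScissors (item `SectorOfSummit` (b), whose value hypothesis is
exactly `LovasAndai2017_rebit_2964.integralRep_value_eq` below; items `RebitCore2964`,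
`Transport`, `FibreReflection` use the same charts).

Source read verbatim (A. Lovas, A. Andai, *Invariance of separability probability over reduced
states in `4 × 4` bipartite systems*, J. Phys. A 50 (2017) 295303 = arXiv:1610.01410, §§1–3):

* §1: "we endow the state space with Hilbert-Schmidt measure … we use the Peres–Horodecki
  criterion which is a simple necessary and sufficient condition for separability of qubit-qubit
  states … Now we give mathematical proof for the `29/64` probability".
* §2: `D_{n,𝕂} = {D ∈ 𝕂^{n×n} | D = D*, D > 0, Tr D = 1}`, `𝕂 = ℝ, ℂ` (faithful states).
* §3: `ρ(D₁, D₂, C) = [[D₁, C], [C*, D₂]]` with `D₁, D₂ > 0`, `D₁ + D₂ ∈ D_{2,𝕂}`,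
  `C ∈ 𝕂^{2×2}`; `Tr₂ ρ(D₁,D₂,C) = D₁ + D₂`; `D_{4,𝕂}(D) = {ρ ∈ D_{4,𝕂} | Tr₂ ρ = D}`; the
  involution `T(ρ(D₁,D₂,C)) = ρ(D₁,D₂,C*)` "is just the composition of partial transpose and
  element-wise conjugation", and "the Peres–Horodecki positive partial transpose criterion can be
  reformulated as `D^s_{4,𝕂} = T(D_{4,𝕂}) ∩ D_{4,𝕂}`"; Theorem 1: `Vol(D^s_{4,𝕂}(D))` as an
  integral, with `Vol(D^s_{4,𝕂}) = λ_{6d+3}(T(D_{4,𝕂}) ∩ D_{4,𝕂})` (Hilbert–Schmidt measure =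
  Lebesgue measure `λ_{6d+3}`, `d = dim_ℝ 𝕂`).
* **Corollary 2**: "If `D ∈ D_{2,𝕂}` is a fixed density matrix, then the probability to find a
  separable state in `D_{4,𝕂}(D)` can be written as `𝒫_sep(𝕂) = ∫_{E_{2,𝕂}} χ̃_d ∘ σ(√((I−Y)/(I+Y)))
  dμ_{d+2}(Y)` … It is apparent that this probability is not depend on `D` that proves the
  conjecture of Milz and Strunz."
* **Theorem 2**: "The separability probability in the rebit-rebit system with respect to the
  Hilbert–Schmidt measure is `𝒫_sep(ℝ) = 29/64`." (Proof: the integral of Corollary 2 equals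
  `(16/35 − 1/4)/(16/35) = 29/64`.)

## Lean rendering

The `9`-dimensional affine space of real symmetric `4 × 4` matrices of trace one is charted by
`y : Fin 9 → ℝ` ↦ `rebitDensity y = [[X, Z], [Zᵀ, Y]]`, `X = [[y0, y2], [y2, y1]]`,
`Y = [[y3, y4], [y4, 1 − y0 − y1 − y3]]`, `Z = [[y5, y6], [y7, y8]]` — an affine bijection onto
the unit-trace symmetric matrices, so the Hilbert–Schmidt (flat) measure is a constant multiple of
Lebesgue measure `volume` on `Fin 9 → ℝ` and RATIOS of volumes are chart-independent. The partial
transpose (Lovas–Andai's `T`; for real matrices `C* = Cᵀ`) is `rebitDensityPT y = [[X, Zᵀ], [Z, Y]]`.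
The bodies are `rebitStateBody = {y | rebitDensity y ≽ 0}` and
`rebitPPTBody = {y | rebitDensity y ≽ 0 ∧ rebitDensityPT y ≽ 0}` (`Matrix.PosSemidef`), and the
theorem is vendored as the named fact (D-0014)

  `LovasAndai2017_rebit_2964 : 64 * volume rebitPPTBody = 29 * volume rebitStateBody` (in `ℝ≥0∞`).

Closed versus open bodies: Lovas–Andai's `D_{4,ℝ}` consists of the faithful (`> 0`) states; the
closed bodies used here (the convention of Życzkowski–Sommers, Slater and Milz–Strunz, and of the
consumer route) differ from the open ones by subsets of the algebraic hypersurfaces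
`{det ρ = 0}`, `{det ρ^Γ = 0}`, which are Lebesgue-null, so the printed ratio is unchanged. The
fibre form (Corollary 2 with Theorem 2) is vendored as `LovasAndai2017_rebit_fibre_2964` over the
`7`-dimensional chart `rebitFibreDensity D x = [[X, Z], [Zᵀ, D − X]]` of `D_{4,ℝ}(D)`, for every
faithful `D` (`D.PosDef`, `Tr D = 1`); at `D = ½·1` this is the chart of the route's `RebitCore2964`.

## Contents (besides the two facts, everything is proved)

* `rebitDensity`, `rebitDensityPT`, `rebitStateBody`, `rebitPPTBody`; `trace_rebitDensity`,
  `rebitDensity_isHermitian`, `rebitDensityPT_isHermitian`, `rebitPPTBody_subset`.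
* Non-vacuity: `abs_le_one_of_mem_rebitStateBody` (every coordinate of a state is in `[−1, 1]`,
  from `vᵀρv ≥ 0` at `v = eᵢ, eᵢ ± eⱼ`), `rebitStateBody_subset_Icc`, `isBounded_rebitStateBody`,
  `volume_rebitStateBody_lt_top`, `volume_rebitPPTBody_lt_top`, `centre_mem_rebitPPTBody` (the
  maximally mixed state `¼·1` is PPT).
* `LovasAndai2017_rebit_2964` (fact) with proved corollaries `.toReal`
  (`64 · vol P = 29 · vol D` in `ℝ`) and `.integralRep_value_eq` — the value identity for the
  route's typed `KZ.IntegralRep 9` representations `[P_ℝ, 64]`, `[D_ℝ, 29]`, literally the inner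
  statement of `SectorOfSummit` (b).
* `rebitFibreDensity`, `rebitFibreDensityPT`, `rebitFibreBody`, `rebitFibrePPTBody`,
  `LovasAndai2017_rebit_fibre_2964` (fact), `rebitFibreDensity_half` (the central fibre is the
  route's chart).

## Not here

The complex (two-qubit) probability `8/33` (Lovas–Andai give an integral formula only; proved
later by others), Theorem 1's integral formula and the defect function `χ̃₁` (Lemma 6), the
`√x`-monotone-metric results (Thms 3–4), the Fubini passage fibre ⇒ global, and positivity of
`volume rebitStateBody` (only finiteness and a PPT point are recorded).

## References

* [LovasAndai2017] A. Lovas, A. Andai, Invariance of separability probability over reduced states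
  in 4 × 4 bipartite systems, J. Phys. A: Math. Theor. 50 (2017) 295303, arXiv:1610.01410, §§2–3,
  Theorem 1, Corollary 2, Theorem 2.
* [MilzStrunz2014] S. Milz, W. T. Strunz, Volumes of conditioned bipartite state spaces, J. Phys.
  A 48 (2015) 035306 (the fibre-invariance conjecture proved by Corollary 2).
-/

noncomputable section

open MeasureTheory Set
open scoped ENNReal Matrix

namespace Literature.InformationTheory.Entanglement

/-! ### The chart of two-rebit states and the two bodies -/

/-- The affine chart of `4 × 4` real symmetric matrices of trace `1` by `y ∈ ℝ⁹`:
`ρ(y) = [[X, Z], [Zᵀ, Y]]` with `X = [[y0, y2], [y2, y1]]`, `Y = [[y3, y4], [y4, 1 − y0 − y1 − y3]]`,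
`Z = [[y5, y6], [y7, y8]]` — Lovas–Andai's `ρ(D₁, D₂, C)` with `D₁ = X`, `D₂ = Y`, `C = Z`, the
unit-trace condition solved for the last diagonal entry. [cite: LovasAndai2017, §3 (parametrisation ρ(D₁,D₂,C))] -/
def rebitDensity (y : Fin 9 → ℝ) : Matrix (Fin 4) (Fin 4) ℝ :=
  !![y 0, y 2, y 5, y 6; y 2, y 1, y 7, y 8; y 5, y 7, y 3, y 4; y 6, y 8, y 4, 1 - y 0 - y 1 - y 3]

/-- The partial transpose of `rebitDensity y`: `[[X, Zᵀ], [Z, Y]]`, i.e. Lovas–Andai's involution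
`T(ρ(D₁, D₂, C)) = ρ(D₁, D₂, C*)` ("the composition of partial transpose and element-wise
conjugation"; for real `C`, `C* = Cᵀ`). [cite: LovasAndai2017, §3 (the involution T)] -/
def rebitDensityPT (y : Fin 9 → ℝ) : Matrix (Fin 4) (Fin 4) ℝ :=
  !![y 0, y 2, y 5, y 7; y 2, y 1, y 6, y 8; y 5, y 6, y 3, y 4; y 7, y 8, y 4, 1 - y 0 - y 1 - y 3]

/-- The body `D_ℝ` of two-rebit states in the chart: `{y | ρ(y) ≽ 0}` (closed version of
Lovas–Andai's `D_{4,ℝ}`, which has `> 0`; the difference is Lebesgue-null). [cite: LovasAndai2017, §2–§3 (D_{4,𝕂})] -/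
def rebitStateBody : Set (Fin 9 → ℝ) :=
  {y | (rebitDensity y).PosSemidef}

/-- The PPT (= separable, Peres–Horodecki for `2 ⊗ 2`) sub-body `P_ℝ = {y | ρ(y) ≽ 0 ∧ ρ(y)^Γ ≽ 0}`,
Lovas–Andai's `D^s_{4,ℝ} = T(D_{4,ℝ}) ∩ D_{4,ℝ}` (closed version). [cite: LovasAndai2017, §3 (D^s = T(D) ∩ D)] -/
def rebitPPTBody : Set (Fin 9 → ℝ) :=
  {y | (rebitDensity y).PosSemidef ∧ (rebitDensityPT y).PosSemidef}

variable {y : Fin 9 → ℝ}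

/-- Membership in `rebitStateBody`. [cite: LovasAndai2017, §3] -/
theorem mem_rebitStateBody_iff : y ∈ rebitStateBody ↔ (rebitDensity y).PosSemidef := Iff.rfl

/-- Membership in `rebitPPTBody`. [cite: LovasAndai2017, §3] -/
theorem mem_rebitPPTBody_iff :
    y ∈ rebitPPTBody ↔ (rebitDensity y).PosSemidef ∧ (rebitDensityPT y).PosSemidef := Iff.rfl

/-- `P_ℝ ⊆ D_ℝ`. [cite: LovasAndai2017, §3 (D^s = T(D) ∩ D)] -/
theorem rebitPPTBody_subset : rebitPPTBody ⊆ rebitStateBody := fun _ h => h.1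

/-- The chart lands in the unit-trace matrices: `Tr ρ(y) = 1`. [cite: LovasAndai2017, §2 (Tr D = 1)] -/
theorem trace_rebitDensity (y : Fin 9 → ℝ) : (rebitDensity y).trace = 1 := by
  simp [rebitDensity, Matrix.trace, Fin.sum_univ_four]

/-- The partial transpose preserves the trace. [cite: LovasAndai2017, §3] -/
theorem trace_rebitDensityPT (y : Fin 9 → ℝ) : (rebitDensityPT y).trace = 1 := by
  simp [rebitDensityPT, Matrix.trace, Fin.sum_univ_four]

/-- `ρ(y)` is symmetric (self-adjoint). [cite: LovasAndai2017, §2 (D = D*)] -/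
theorem rebitDensity_isHermitian (y : Fin 9 → ℝ) : (rebitDensity y).IsHermitian := by
  apply Matrix.IsHermitian.ext
  intro i j
  fin_cases i <;> fin_cases j <;> simp [rebitDensity]

/-- `ρ(y)^Γ` is symmetric (self-adjoint). [cite: LovasAndai2017, §3] -/
theorem rebitDensityPT_isHermitian (y : Fin 9 → ℝ) : (rebitDensityPT y).IsHermitian := by
  apply Matrix.IsHermitian.ext
  intro i j
  fin_cases i <;> fin_cases j <;> simp [rebitDensityPT]

/-! ### Non-vacuity: the bodies are bounded and contain the maximally mixed state -/

/-- The quadratic form of a state is non-negative (unfolding of `Matrix.PosSemidef` over `ℝ`).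
[folklore] -/
theorem dotProduct_mulVec_rebitDensity_nonneg (h : y ∈ rebitStateBody) (v : Fin 4 → ℝ) :
    0 ≤ v ⬝ᵥ (rebitDensity y *ᵥ v) := by
  simpa using h.dotProduct_mulVec_nonneg v

/-- **Every coordinate of a state lies in `[−1, 1]`**: the diagonal entries `y0, y1, y3,
1 − y0 − y1 − y3` are `≥ 0` (`v = eᵢ`), hence `≤ 1`, and each off-diagonal entry `y_k = ρᵢⱼ`
satisfies `2|y_k| ≤ ρᵢᵢ + ρⱼⱼ ≤ 1` (`v = eᵢ ± eⱼ`). [folklore] -/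
theorem abs_le_one_of_mem_rebitStateBody (h : y ∈ rebitStateBody) (i : Fin 9) : |y i| ≤ 1 := by
  have q := dotProduct_mulVec_rebitDensity_nonneg h
  have h0 := q ![1, 0, 0, 0]
  have h1 := q ![0, 1, 0, 0]
  have h2 := q ![0, 0, 1, 0]
  have h3 := q ![0, 0, 0, 1]
  have h01p := q ![1, 1, 0, 0]
  have h01m := q ![1, -1, 0, 0]
  have h02p := q ![1, 0, 1, 0]
  have h02m := q ![1, 0, -1, 0]
  have h03p := q ![1, 0, 0, 1]
  have h03m := q ![1, 0, 0, -1]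
  have h12p := q ![0, 1, 1, 0]
  have h12m := q ![0, 1, -1, 0]
  have h13p := q ![0, 1, 0, 1]
  have h13m := q ![0, 1, 0, -1]
  have h23p := q ![0, 0, 1, 1]
  have h23m := q ![0, 0, 1, -1]
  simp [rebitDensity, Matrix.mulVec, dotProduct, Fin.sum_univ_four] at h0 h1 h2 h3 h01p h01m h02p h02m h03p h03m h12p h12m h13p h13m h23p h23m
  fin_cases i
  all_goals
    rw [abs_le]
    try simp only [Fin.zero_eta, Fin.isValue, Fin.mk_one, Fin.reduceFinMk]
    constructor <;> linarith

/-- `D_ℝ` lies in the cube `[−1, 1]⁹`. [folklore] -/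
theorem rebitStateBody_subset_Icc : rebitStateBody ⊆ Set.Icc (-1 : Fin 9 → ℝ) 1 := by
  intro y hy
  simp only [Set.mem_Icc]
  constructor
  · intro i
    have := abs_le_one_of_mem_rebitStateBody hy i
    simp only [Pi.neg_apply, Pi.one_apply]
    exact (abs_le.1 this).1
  · intro i
    have := abs_le_one_of_mem_rebitStateBody hy i
    simp only [Pi.one_apply]
    exact (abs_le.1 this).2

/-- `D_ℝ` is bounded. [folklore] -/
theorem isBounded_rebitStateBody : Bornology.IsBounded rebitStateBody :=
  (Metric.isBounded_Icc (-1 : Fin 9 → ℝ) 1).subset rebitStateBody_subset_Icc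

/-- `P_ℝ` is bounded. [folklore] -/
theorem isBounded_rebitPPTBody : Bornology.IsBounded rebitPPTBody :=
  isBounded_rebitStateBody.subset rebitPPTBody_subset

/-- The Hilbert–Schmidt volume of `D_ℝ` is finite (so the fact below is not an identity `∞ = ∞`).
[folklore] -/
theorem volume_rebitStateBody_lt_top : volume rebitStateBody < ∞ :=
  isBounded_rebitStateBody.measure_lt_top

/-- The Hilbert–Schmidt volume of `P_ℝ` is finite. [folklore] -/
theorem volume_rebitPPTBody_lt_top : volume rebitPPTBody < ∞ :=
  isBounded_rebitPPTBody.measure_lt_top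

/-- The chart point of the maximally mixed state `¼·1`: `y0 = y1 = y3 = ¼`, all other coordinates
`0`. [folklore] -/
def rebitCentre : Fin 9 → ℝ := ![1 / 4, 1 / 4, 0, 1 / 4, 0, 0, 0, 0, 0]

/-- At the centre the density matrix is `¼·1`. [folklore] -/
theorem rebitDensity_rebitCentre :
    rebitDensity rebitCentre = (1 / 4 : ℝ) • (1 : Matrix (Fin 4) (Fin 4) ℝ) := by
  ext i j
  have h4 : (1 : ℝ) - 4⁻¹ - 4⁻¹ - 4⁻¹ = 4⁻¹ := by norm_num
  fin_cases i <;> fin_cases j <;> simp [rebitDensity, rebitCentre, h4]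

/-- At the centre the partial transpose is `¼·1` as well. [folklore] -/
theorem rebitDensityPT_rebitCentre :
    rebitDensityPT rebitCentre = (1 / 4 : ℝ) • (1 : Matrix (Fin 4) (Fin 4) ℝ) := by
  ext i j
  have h4 : (1 : ℝ) - 4⁻¹ - 4⁻¹ - 4⁻¹ = 4⁻¹ := by norm_num
  fin_cases i <;> fin_cases j <;> simp [rebitDensityPT, rebitCentre, h4]

/-- **The maximally mixed state is PPT** (`¼·1 ≽ 0` and `(¼·1)^Γ = ¼·1 ≽ 0`), so both bodies are
non-empty. [folklore] -/
theorem centre_mem_rebitPPTBody : rebitCentre ∈ rebitPPTBody := by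
  have h : ((1 / 4 : ℝ) • (1 : Matrix (Fin 4) (Fin 4) ℝ)).PosSemidef :=
    Matrix.PosSemidef.one.smul (by norm_num)
  exact ⟨rebitDensity_rebitCentre ▸ h, rebitDensityPT_rebitCentre ▸ h⟩

/-- The maximally mixed state is a state. [folklore] -/
theorem centre_mem_rebitStateBody : rebitCentre ∈ rebitStateBody :=
  rebitPPTBody_subset centre_mem_rebitPPTBody

/-! ### The theorem (named fact) and its consequences -/

/-- **Lovas–Andai 2017, Theorem 2: the Hilbert–Schmidt separability probability of two-rebit
states is `29/64`.** "The separability probability in the rebit-rebit system with respect to the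
Hilbert–Schmidt measure is `𝒫_sep(ℝ) = 29/64`", where (§§1–3) the Hilbert–Schmidt measure on the
`9`-dimensional body `D_{4,ℝ}` of `4 × 4` real density matrices is Lebesgue measure `λ₉`,
separable = PPT by the Peres–Horodecki criterion, `D^s_{4,ℝ} = T(D_{4,ℝ}) ∩ D_{4,ℝ}` with `T` the
partial transpose, and `𝒫_sep(ℝ) = Vol(D^s_{4,ℝ}) / Vol(D_{4,ℝ})`. Rendering (module docstring): in
the affine chart `rebitDensity` of the unit-trace symmetric matrices (flat measure = constant ×
Lebesgue, so the ratio is chart-free), with the closed bodies `rebitPPTBody ⊆ rebitStateBody`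
(Lebesgue-a.e. equal to Lovas–Andai's open ones), cross-multiplied in `ℝ≥0∞`:
`64 · λ₉(P_ℝ) = 29 · λ₉(D_ℝ)`. Both volumes are finite (`volume_rebitStateBody_lt_top`) and the
bodies are non-empty (`centre_mem_rebitPPTBody`). Statement only; the printed proof evaluates the
fibre integral of Corollary 2 to `(16/35 − 1/4)/(16/35)` via Lemma 6 (the defect function `χ̃₁`)
and dilogarithm primitives. [cite: LovasAndai2017, Theorem 2 (with §§2–3 for D_{4,ℝ}, T, D^s and the Hilbert–Schmidt measure)] -/
def LovasAndai2017_rebit_2964 : Prop :=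
  64 * volume rebitPPTBody = 29 * volume rebitStateBody

/-- The theorem in `ℝ`: `64 · vol(P_ℝ) = 29 · vol(D_ℝ)` for the real volumes (`ENNReal.toReal`;
both finite). [cite: LovasAndai2017, Theorem 2] -/
theorem LovasAndai2017_rebit_2964.toReal (h : LovasAndai2017_rebit_2964) :
    64 * (volume rebitPPTBody).toReal = 29 * (volume rebitStateBody).toReal := by
  have h' := congrArg ENNReal.toReal h
  simpa [ENNReal.toReal_mul] using h'

/-- The separability probability as a quotient: `vol(P_ℝ) / vol(D_ℝ) = 29/64` (real volumes),
given that `vol(D_ℝ) ≠ 0`. [cite: LovasAndai2017, Theorem 2] -/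
theorem LovasAndai2017_rebit_2964.div_eq (h : LovasAndai2017_rebit_2964)
    (h0 : (volume rebitStateBody).toReal ≠ 0) :
    (volume rebitPPTBody).toReal / (volume rebitStateBody).toReal = 29 / 64 := by
  rw [div_eq_div_iff h0 (by norm_num : (64 : ℝ) ≠ 0)]
  have := h.toReal
  linarith

/-- **The value identity for the route's typed representations** (route
KontsevichZagierPeriods/SpectrahedralScissors, the inner statement of `SectorOfSummit` (b), real
conjunct): for the chart `ρ` and its partial transpose `ρ'` written as the literal matrices, and
Kontsevich–Zagier integral representations `r = [P_ℝ, 64]`, `r' = [D_ℝ, 29]` in dimension `9`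
(domains the PPT body and the state body, integrands the constants `64`, `29` on the domains),
`r.value = r'.value` — because `r.value = 64 · λ₉(P_ℝ)` and `r'.value = 29 · λ₉(D_ℝ)`
(`setIntegral_const`, measurability of semialgebraic domains) and Theorem 2.
[cite: LovasAndai2017, Theorem 2] -/
theorem LovasAndai2017_rebit_2964.integralRep_value_eq (h : LovasAndai2017_rebit_2964) :
    ∀ (ρ ρ' : (Fin 9 → ℝ) → Matrix (Fin 4) (Fin 4) ℝ),
      (∀ y, ρ y = !![y 0, y 2, y 5, y 6; y 2, y 1, y 7, y 8; y 5, y 7, y 3, y 4;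
        y 6, y 8, y 4, 1 - y 0 - y 1 - y 3]) →
      (∀ y, ρ' y = !![y 0, y 2, y 5, y 7; y 2, y 1, y 6, y 8; y 5, y 6, y 3, y 4;
        y 7, y 8, y 4, 1 - y 0 - y 1 - y 3]) →
      ∀ (r r' : Literature.NumberTheory.Transcendental.KZ.IntegralRep 9),
        r.domain = {y | (ρ y).PosSemidef ∧ (ρ' y).PosSemidef} →
        Set.EqOn r.integrand (fun _ => 64) r.domain →
        r'.domain = {y | (ρ y).PosSemidef} →
        Set.EqOn r'.integrand (fun _ => 29) r'.domain →
        r.value = r'.value := by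
  intro ρ ρ' hρ hρ' r r' hd hi hd' hi'
  have hP : r.domain = rebitPPTBody := by
    rw [hd]
    ext y
    simp only [Set.mem_setOf_eq, hρ, hρ', mem_rebitPPTBody_iff]
    rfl
  have hD : r'.domain = rebitStateBody := by
    rw [hd']
    ext y
    simp only [Set.mem_setOf_eq, hρ, mem_rebitStateBody_iff]
    rfl
  have h1 : r.value = (volume rebitPPTBody).toReal * 64 := by
    rw [Literature.NumberTheory.Transcendental.KZ.IntegralRep.value,
      setIntegral_congr_fun
        (Literature.NumberTheory.Transcendental.KZ.IntegralRep.measurableSet_domain_holds r) hi,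
      setIntegral_const, hP, smul_eq_mul, measureReal_def]
  have h2 : r'.value = (volume rebitStateBody).toReal * 29 := by
    rw [Literature.NumberTheory.Transcendental.KZ.IntegralRep.value,
      setIntegral_congr_fun
        (Literature.NumberTheory.Transcendental.KZ.IntegralRep.measurableSet_domain_holds r') hi',
      setIntegral_const, hD, smul_eq_mul, measureReal_def]
  rw [h1, h2]
  have := h.toReal
  linarith

/-! ### The fibre form (Corollary 2 with Theorem 2) -/

/-- The `7`-dimensional chart of the fibre `D_{4,ℝ}(D) = {ρ | Tr₂ ρ = D}` over a `2 × 2` real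
matrix `D`: `x ↦ [[X, Z], [Zᵀ, D − X]]` with `X = [[x0, x2], [x2, x1]]`, `Z = [[x3, x4], [x5, x6]]`
(Lovas–Andai: `Tr₂ ρ(D₁, D₂, C) = D₁ + D₂`; here `D₁ = X`, `D₂ = D − X`, `C = Z`).
[cite: LovasAndai2017, §3 (Tr₂ ρ(D₁,D₂,C) = D₁ + D₂ and D_{4,𝕂}(D))] -/
def rebitFibreDensity (D : Matrix (Fin 2) (Fin 2) ℝ) (x : Fin 7 → ℝ) : Matrix (Fin 4) (Fin 4) ℝ :=
  !![x 0, x 2, x 3, x 4; x 2, x 1, x 5, x 6; x 3, x 5, D 0 0 - x 0, D 0 1 - x 2;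
    x 4, x 6, D 1 0 - x 2, D 1 1 - x 1]

/-- The partial transpose on the fibre chart: `[[X, Zᵀ], [Z, D − X]]`. [cite: LovasAndai2017, §3 (the involution T)] -/
def rebitFibreDensityPT (D : Matrix (Fin 2) (Fin 2) ℝ) (x : Fin 7 → ℝ) :
    Matrix (Fin 4) (Fin 4) ℝ :=
  !![x 0, x 2, x 3, x 5; x 2, x 1, x 4, x 6; x 3, x 4, D 0 0 - x 0, D 0 1 - x 2;
    x 5, x 6, D 1 0 - x 2, D 1 1 - x 1]

/-- The fibre body `D_{4,ℝ}(D)` in the chart (closed version). [cite: LovasAndai2017, §3 (D_{4,𝕂}(D))] -/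
def rebitFibreBody (D : Matrix (Fin 2) (Fin 2) ℝ) : Set (Fin 7 → ℝ) :=
  {x | (rebitFibreDensity D x).PosSemidef}

/-- The PPT part `D^s_{4,ℝ}(D)` of the fibre body (closed version). [cite: LovasAndai2017, §3 and Theorem 1 (D^s_{4,𝕂}(D))] -/
def rebitFibrePPTBody (D : Matrix (Fin 2) (Fin 2) ℝ) : Set (Fin 7 → ℝ) :=
  {x | (rebitFibreDensity D x).PosSemidef ∧ (rebitFibreDensityPT D x).PosSemidef}

/-- The PPT fibre body is contained in the fibre body. [cite: LovasAndai2017, §3] -/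
theorem rebitFibrePPTBody_subset (D : Matrix (Fin 2) (Fin 2) ℝ) :
    rebitFibrePPTBody D ⊆ rebitFibreBody D := fun _ h => h.1

/-- The partial trace of the fibre chart is `D`: the two diagonal blocks sum to `D`
(entrywise, for symmetric `D`). [cite: LovasAndai2017, §3 (Tr₂ ρ = D₁ + D₂)] -/
theorem rebitFibreDensity_blocks_sum (D : Matrix (Fin 2) (Fin 2) ℝ) (hD : D.IsHermitian)
    (x : Fin 7 → ℝ) (i j : Fin 2) :
    rebitFibreDensity D x (Fin.castAdd 2 i) (Fin.castAdd 2 j) +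
        rebitFibreDensity D x (Fin.natAdd 2 i) (Fin.natAdd 2 j) = D i j := by
  have h10 : D 1 0 = D 0 1 := by
    simpa using (congrFun (congrFun hD 1) 0).symm
  fin_cases i <;> fin_cases j <;> simp [rebitFibreDensity, h10]

/-- **Lovas–Andai 2017, Corollary 2 with Theorem 2: on EVERY fibre over a faithful reduced state
the two-rebit separability probability is `29/64` (Milz–Strunz invariance).** Corollary 2: "If
`D ∈ D_{2,𝕂}` is a fixed density matrix, then the probability to find a separable state in
`D_{4,𝕂}(D)` can be written as `∫_{E_{2,𝕂}} χ̃_d ∘ σ(√((I−Y)/(I+Y))) dμ_{d+2}(Y)` … this probability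
is not depend on `D`", and Theorem 2 evaluates this integral for `𝕂 = ℝ` to `29/64`. Rendering: for
every real `2 × 2` matrix `D` which is positive definite (faithful, `D ∈ D_{2,ℝ}`) with `Tr D = 1`,
in the `7`-dimensional chart `rebitFibreDensity D` of the fibre (flat fibre measure = constant ×
Lebesgue measure `λ₇`; Lovas–Andai's fibre coordinates `(A, C) = (2X − D, Z)` differ by a linear map
of constant Jacobian), with closed bodies, `64 · λ₇(P_ℝ(D)) = 29 · λ₇(D_ℝ(D))` in `ℝ≥0∞`. At
`D = ½·1` this is the value side of the route item `RebitCore2964` (`rebitFibreDensity_half`).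
Statement only. [cite: LovasAndai2017, Corollary 2 and Theorem 2] -/
def LovasAndai2017_rebit_fibre_2964 : Prop :=
  ∀ D : Matrix (Fin 2) (Fin 2) ℝ, D.PosDef → D.trace = 1 →
    64 * volume (rebitFibrePPTBody D) = 29 * volume (rebitFibreBody D)

/-- The central fibre `D = ½·1` is the chart of the route's `RebitCore2964`:
`ρ(x) = [[x0, x2, x3, x4], [x2, x1, x5, x6], [x3, x5, ½ − x0, −x2], [x4, x6, −x2, ½ − x1]]`.
[cite: LovasAndai2017, §3] -/
theorem rebitFibreDensity_half (x : Fin 7 → ℝ) :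
    rebitFibreDensity ((2 : ℝ)⁻¹ • (1 : Matrix (Fin 2) (Fin 2) ℝ)) x =
      !![x 0, x 2, x 3, x 4; x 2, x 1, x 5, x 6; x 3, x 5, 1 / 2 - x 0, -x 2;
        x 4, x 6, -x 2, 1 / 2 - x 1] := by
  ext i j
  fin_cases i <;> fin_cases j <;> simp [rebitFibreDensity]

/-- The partial transpose on the central fibre, in the route's literal form. [cite: LovasAndai2017, §3] -/
theorem rebitFibreDensityPT_half (x : Fin 7 → ℝ) :
    rebitFibreDensityPT ((2 : ℝ)⁻¹ • (1 : Matrix (Fin 2) (Fin 2) ℝ)) x =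
      !![x 0, x 2, x 3, x 5; x 2, x 1, x 4, x 6; x 3, x 4, 1 / 2 - x 0, -x 2;
        x 5, x 6, -x 2, 1 / 2 - x 1] := by
  ext i j
  fin_cases i <;> fin_cases j <;> simp [rebitFibreDensityPT]

/-- `½·1 ∈ D_{2,ℝ}`: it is positive definite with trace `1`, so the fibre fact applies to the
central fibre. [folklore] -/
theorem half_posDef_and_trace :
    ((2 : ℝ)⁻¹ • (1 : Matrix (Fin 2) (Fin 2) ℝ)).PosDef ∧
      ((2 : ℝ)⁻¹ • (1 : Matrix (Fin 2) (Fin 2) ℝ)).trace = 1 := by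
  refine ⟨Matrix.PosDef.one.smul (by norm_num), ?_⟩
  simp [Matrix.trace]

/-- **The central fibre** (consequence of the fibre fact): in the route's `7`-dimensional chart,
`64 · λ₇ {x | ρ(x) ≽ 0 ∧ ρ(x)^Γ ≽ 0} = 29 · λ₇ {x | ρ(x) ≽ 0}`. [cite: LovasAndai2017, Corollary 2 and Theorem 2] -/
theorem LovasAndai2017_rebit_fibre_2964.half (h : LovasAndai2017_rebit_fibre_2964) :
    64 * volume {x : Fin 7 → ℝ |
        (!![x 0, x 2, x 3, x 4; x 2, x 1, x 5, x 6; x 3, x 5, 1 / 2 - x 0, -x 2;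
            x 4, x 6, -x 2, 1 / 2 - x 1] : Matrix (Fin 4) (Fin 4) ℝ).PosSemidef ∧
          (!![x 0, x 2, x 3, x 5; x 2, x 1, x 4, x 6; x 3, x 4, 1 / 2 - x 0, -x 2;
            x 5, x 6, -x 2, 1 / 2 - x 1] : Matrix (Fin 4) (Fin 4) ℝ).PosSemidef} =
      29 * volume {x : Fin 7 → ℝ |
        (!![x 0, x 2, x 3, x 4; x 2, x 1, x 5, x 6; x 3, x 5, 1 / 2 - x 0, -x 2;
            x 4, x 6, -x 2, 1 / 2 - x 1] : Matrix (Fin 4) (Fin 4) ℝ).PosSemidef} := by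
  have key := h _ half_posDef_and_trace.1 half_posDef_and_trace.2
  simp only [rebitFibrePPTBody, rebitFibreBody, rebitFibreDensity_half,
    rebitFibreDensityPT_half] at key
  exact key

end Literature.InformationTheory.Entanglement

end
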